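import Summits.HodgeConjecture.HodgeConjecture.Theorems.F0P3UnitaryLocOfRecord          -- (B-i) ★-pending: `clInfChoiceU`, `tokenInfU_of_exists_cohUnitaryToken`, `IsCohUnitaryClass`; cone: ★ `F0P3ArchTokenUnitary`, ★ `F0P3bArchDegOneClass`
import Summits.HodgeConjecture.HodgeConjecture.Theorems.F0P3ArchIsotypyConj            -- ★ p803493: `star_mem_archModule`, `coe_archRepK_conj`, `coe_archRepLie_conj`, `contDiff_rightRegular_star`, `archIsotypy_cm_of_hol_half`
import Summits.HodgeConjecture.HodgeConjecture.Theorems.F0P3GKModuleConjVec              -- ★ B6a: `isGKModule_repConj`, `isIrreducibleGK_repConj`, `isAdmissibleGK_repConj` on `ConjVec`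
import HarnessLib

/-!
# Crux `H413`, floor 0, programme F0P3 — «UL» (B-ii): THE ANTIHOLOMORPHIC COH-UNITARY TOKEN (conjugation transport) and law `TokenInf` at `𝔠₀`
# for the unitarity-first token `clInfChoiceU` under the head's guard `IsCot` (BOTH disjuncts)

Cell hodgecm-mathlib (D-0151), sub-cell F0/P3 «U3-mult»; pen F0P3-p02 (g7); crux item stmt-HodgeConjecture-24833 (`HCCMUnconditional.H413`); F0P3-plan (g5)
RULING (V35) (1) «(B-ii) NEXT: conj transport + `tokenInfU_of_isCot` — so `TokenInf`@𝔠₀ stays a THEOREM under the head's `IsCot` guard for BOTH disjuncts».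
PROOF lane (`--kind proof --supports stmt-HodgeConjecture-24833 --as helper`): theorems only; no `def`, no instance, no notation, no named fact, no `sorry`.

THE MATHEMATICS.  (§1, generic `U(α, β)`) The conjugate `V̄ = (ConjVec V, repConj ρK, conjRep ρ𝔤)` of a `(𝔤, K)`-module that is unitary along `𝔭 ⊕ ℝz₀`
(P3b's ★ `IsUnitaryAlongP`: a positive-definite REAL symmetric form, `𝔭`-frame and `z₀` skew, `B(ia, b) = −B(a, ib)`) is again unitary along `𝔭 ⊕ ℝz₀` — the SAME
real form read through the identity `V̄ = V` (the operators `ρ𝔤(X)` are unchanged; only `i` acts by `−i`, and `B(−ia, b) = B(a, ib) = −B(a, −i·̄b)`); with ★ B6a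
(`IsGKModule`, irreducibility, admissibility pass to `V̄`) the bundle ★ `IsCohUnitaryIrrep` passes to `V̄` (`isCohUnitaryIrrep_repConj`).  (§2, generic discrete
`P` of any `𝒢`, any real group `G` with `ιG`) A token `T : P̄.archModule → M` of the CONJUGATE representation `P̄` yields the token `u ↦ \overline{T(ū)} :
P.archModule → M̄` of `P` (the conjugation `u ↦ ū`, ★ `star_mem_archModule`, intertwines the `K`- and `𝔤`-actions read in `L²`, ★ `coe_archRepK_conj` ∕
`coe_archRepLie_conj`; it is ONTO `P̄.archModule` because `\bar{\bar u} = u`, ★ `mem_conj_space_iff` + ★ `mem_archModule_iff_coe`, so the new token is non-zero).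
(§3, CM) An ANTIHOLOMORPHIC-cotangent `P` has holomorphic `P̄` (★ `isAntiholCotangentAt_iff_conj`), which has a coh-unitary token (★ `F0P3ArchTokenUnitary.
exists_cohUnitaryIrrep_token_of_isHolCotangentAt_cpt`); conjugating it gives a COH-UNITARY TOKEN OF `P`.  (§4) Hence law `TokenInf` at `𝔠₀` for `clInf := clInfChoiceU dflt ∘ rep`
holds for antiholomorphic `P` (F1a there is ★ `archIsotypy_cm_of_hol_half` ∘ ★ `archIsotypy_of_isHolCotangentAt`), and for `IsCot P` = hol ∨ antihol (`tokenInfU_of_isCot`).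

* §1 `isUnitaryAlongP_conjRep`, `isCohUnitaryIrrep_repConj`.
* §2 `mem_archModule_of_coe_eq_star_conj` (`\bar w ∈ P.archModule` for `w ∈ P̄.archModule`), `exists_token_conjVec_of_conj_token`.
* §3 `exists_cohUnitaryToken_of_isAntiholCotangentAt_cpt`, `exists_cohUnitaryToken_of_isHolCotangentAt_cpt` (re-bundled ★), `exists_cohUnitaryToken_of_isCot_cpt`.
* §4 `tokenInfU_of_isAntiholCotangentAt`, **`tokenInfU_of_isCot`** — law `TokenInf` (dossier v5 :471) at `𝔠₀` with `clInf := clInfChoiceU dflt ∘ rep`, under the guard `IsCot`.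
HONEST LABEL: HC_CM is proved only modulo the printed citations until rung 0 closes; this file discharges none of them.
References: A. Borel, N. Wallach, AMS (2000), 0 §2.5, II §4.2, VI Thm. 4.11, VII 2.10 [BorelWallach2000]; L. Clozel, *Motifs et formes automorphes* (1990) §3.1
[Clozel1990]; A. Knapp, D. Vogan (1995) §VI.2 [KnappVogan1995]; J. Rogawski, Ann. of Math. Stud. 123 (1990), Prop. 15.2.1 (b), §15.3 [Rogawski1990];
A. Borel, H. Jacquet, PSPM 33.1 (1979) §4.6 [BorelJacquet1979].
-/

set_option autoImplicit false
-- the mandated namespace has the single-problem summit's repeated segment (`HodgeConjecture.HodgeConjecture`)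
set_option linter.dupNamespace false

-- Mathlib idiom (Mathlib/Algebra/Lie/OfAssociative.lean; as in ★ `GKModules` and every `(𝔤, K)` file of the tree):
-- the commutator bracket on `Module.End ℂ M`, needed to MENTION `𝔲(2,1) →ₗ⁅ℝ⁆ Module.End ℂ M`.
attribute [local instance 100] LieRing.ofAssociativeRing

noncomputable section
namespace Summit.HodgeConjecture.HodgeConjecture.Cruxes.H413.F0P3AntiholCohUnitaryToken

open scoped Matrix MatrixGroups ComplexOrder
open MeasureTheory NumberField NumberField.InfinitePlace IsDedekindDomain
open Literature.NumberTheory.Automorphic Literature.NumberTheory.Automorphic.UnitaryGroup Literature.NumberTheory.Automorphic.ConjVec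
open Literature.NumberTheory.Automorphic.UnitaryGroup.CotangentForms (cmArchSection cmCompactFactor)
open Literature.RepresentationTheory.BorelWallach2000
open Literature.RepresentationTheory.KonnoKonno2007 Literature.RepresentationTheory.KonnoKonno2007.RealDualPair Literature.RepresentationTheory.KonnoKonno2007.RealDualPair.UForm
open Summit.HodgeConjecture.HodgeConjecture.Cruxes.H413.F0P3InnerFormClassification (HasToken Cinf Gp)
open Summit.HodgeConjecture.HodgeConjecture.Cruxes.H413.F0P3ClassTokensOfRecord (Cls cl rep)
open Summit.HodgeConjecture.HodgeConjecture.Cruxes.H413.F0P3bArchDegOnePackage (IsUnitaryAlongP IsCohUnitaryIrrep)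
open Summit.HodgeConjecture.HodgeConjecture.Cruxes.H413.F0P3GKModuleConjVec (isGKModule_repConj isIrreducibleGK_repConj isAdmissibleGK_repConj)
open Summit.HodgeConjecture.HodgeConjecture.Cruxes.H413.F0P3ArchIsotypyConj
open Summit.HodgeConjecture.HodgeConjecture.Cruxes.H413.F0P3UnitaryLocOfRecord

/-! ## §1 Unitarity along `𝔭 ⊕ ℝz₀` passes to the conjugate module -/

section Conj

variable {α β : Type*} [Fintype α] [DecidableEq α] [Fintype β] [DecidableEq β]
  {V : Type*} [AddCommGroup V] [Module ℂ V]
  {ρK : Representation ℂ (uFormGroup α β).maximalCompact V} {ρ𝔤 : (uFormGroup α β).lie →ₗ⁅ℝ⁆ Module.End ℂ V}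

/-- **`V̄` is unitary along `𝔭 ⊕ ℝz₀` when `V` is**: the real form `B` of `V` read through `V̄ = V` (the inverse of ★ `toConj`, real-linear since
`\overline{r} = r` for `r ∈ ℝ`) is symmetric, positive definite, skew for the unchanged operators `ρ̄𝔤(x_s) = ρ𝔤(x_s)`, `ρ̄𝔤(z₀) = ρ𝔤(z₀)`, and satisfies
`B(i ·̄ a, b) = B(−ia, b) = −B(a, −ib) = −B(a, i ·̄ b)`. [cite: BorelWallach2000, 0 §2.5; II §4.2] [cite: KnappVogan1995, §VI.2] -/
theorem isUnitaryAlongP_conjRep (h : IsUnitaryAlongP ρ𝔤) : IsUnitaryAlongP (ConjVec.conjRep ρ𝔤) := by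
  obtain ⟨B, hsym, hnn, hdef, hP, hZ, hI⟩ := h
  -- read the form on `V` itself
  let B₀ : V →ₗ[ℝ] V →ₗ[ℝ] ℝ := B
  have hsym₀ : ∀ a b : V, B₀ a b = B₀ b a := hsym
  have hnn₀ : ∀ a : V, 0 ≤ B₀ a a := hnn
  have hdef₀ : ∀ a : V, B₀ a a = 0 → a = 0 := hdef
  have hP₀ : ∀ (s : (α × β) × Fin 2) (a b : V), B₀ (ρ𝔤 (upqPBasis s) a) b = -B₀ a (ρ𝔤 (upqPBasis s) b) := hP
  have hZ₀ : ∀ a b : V, B₀ (ρ𝔤 (upqZ0 α β) a) b = -B₀ a (ρ𝔤 (upqZ0 α β) b) := hZ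
  have hI₀ : ∀ a b : V, B₀ (Complex.I • a) b = -B₀ a (Complex.I • b) := hI
  -- the identity `V̄ → V` as a REAL-linear map
  let e : ConjVec V →ₗ[ℝ] V :=
    { toFun := fun a => (toConj (V := V)).symm a
      map_add' := fun a b => map_add _ a b
      map_smul' := fun r a => by
        rw [RingHom.id_apply, ← Complex.coe_smul, LinearEquiv.map_smulₛₗ, Complex.conj_ofReal, Complex.coe_smul] }
  have he : ∀ a : ConjVec V, e a = (toConj (V := V)).symm a := fun _ => rfl
  have he𝔤 : ∀ (X : (uFormGroup α β).lie) (a : ConjVec V), e (ConjVec.conjRep ρ𝔤 X a) = ρ𝔤 X (e a) := fun _ _ => rfl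
  have heI : ∀ a : GKCarrier (uFormGroup α β) (ConjVec.conjRep ρ𝔤), e (Complex.I • a) = -(Complex.I • e a) := fun a => by
    change (toConj (V := V)).symm (Complex.I • (show ConjVec V from a)) = -(Complex.I • (toConj (V := V)).symm (show ConjVec V from a))
    rw [LinearEquiv.map_smulₛₗ, Complex.conj_I, neg_smul]
  have heinj : ∀ a : ConjVec V, e a = 0 → a = 0 := fun a ha => (toConj (V := V)).symm.map_eq_zero_iff.mp ha
  -- the transported form on the `(𝔤, K)`-carrier of `V̄`
  let B' : GKCarrier (uFormGroup α β) (ConjVec.conjRep ρ𝔤) →ₗ[ℝ] GKCarrier (uFormGroup α β) (ConjVec.conjRep ρ𝔤) →ₗ[ℝ] ℝ :=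
    B₀.compl₁₂ e e
  have hB' : ∀ a b : ConjVec V, B' a b = B₀ (e a) (e b) := fun _ _ => rfl
  refine ⟨B', fun a b => ?_, fun a => ?_, fun a ha => ?_, fun s a b => ?_, fun a b => ?_, fun a b => ?_⟩
  · exact (hB' a b).trans ((hsym₀ _ _).trans (hB' b a).symm)
  · rw [hB']; exact hnn₀ _
  · exact heinj a (hdef₀ _ ((hB' a a).symm.trans ha))
  · change B' (ConjVec.conjRep ρ𝔤 (upqPBasis s) a) b = -B' a (ConjVec.conjRep ρ𝔤 (upqPBasis s) b)
    rw [hB', hB', he𝔤, he𝔤]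
    exact hP₀ s _ _
  · change B' (ConjVec.conjRep ρ𝔤 (upqZ0 α β) a) b = -B' a (ConjVec.conjRep ρ𝔤 (upqZ0 α β) b)
    rw [hB', hB', he𝔤, he𝔤]
    exact hZ₀ _ _
  · rw [hB', hB', heI, heI, map_neg, LinearMap.neg_apply, map_neg, hI₀, neg_neg]

/-- **The conjugate of an irreducible unitary cohomological module is one** (`IsCohUnitaryIrrep` passes to `(ConjVec V, repConj ρK, conjRep ρ𝔤)`: ★ B6a for
`IsGKModule` ∕ irreducibility ∕ admissibility, §1 for unitarity along `𝔭 ⊕ ℝz₀`). [cite: BorelWallach2000, 0 §2.5; VI Thm. 4.11] [cite: KnappVogan1995, §VI.2] -/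
theorem isCohUnitaryIrrep_repConj (h : IsCohUnitaryIrrep ρK ρ𝔤) : IsCohUnitaryIrrep (ConjVec.repConj ρK) (ConjVec.conjRep ρ𝔤) :=
  ⟨isGKModule_repConj (uFormGroup α β) h.gk, isIrreducibleGK_repConj (uFormGroup α β) h.irred, isAdmissibleGK_repConj (uFormGroup α β) h.adm,
    isUnitaryAlongP_conjRep h.unit⟩

end Conj

/-! ## §2 Tokens of `P̄` conjugate to tokens of `P` (generic discrete `P`, generic real group) -/

section Generic

variable {K : Type} [Field K] [NumberField K] {𝒢 : AdelicGroupData K}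
  {μ : Measure 𝒢.automorphicQuotient} [𝒢.IsAutomorphicMeasure μ]
  {A : Type*} [NormedCommRing A] [NormedAlgebra ℝ A] [NormedAlgebra ℚ A] [CompleteSpace A]
  [StarRing A] [FiniteDimensional ℝ A] {N : Type*} [Fintype N] [DecidableEq N]
  (P : DiscreteAutomorphicRep 𝒢 μ) (G : RealMatrixGroup A N) (ιG : G.carrier →* 𝒢.Adelic)

omit [FiniteDimensional ℝ A] in
/-- **`\bar w ∈ P.archModule` for `w ∈ P̄.archModule`** (the converse companion of ★ `star_mem_archModule`: smoothness and `K`-finiteness are read in `L²`,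
★ `mem_archModule_iff_coe`, and preserved by `f ↦ f̄`, ★ `contDiff_rightRegular_star` ∕ `finiteDimensional_span_rightRegular_star`). [cite: BorelJacquet1979, §4.6]
[cite: BorelWallach2000, 0 §2.4] -/
theorem mem_archModule_of_coe_eq_star_conj {w : P.conj.space.toSubmodule} (hw : w ∈ P.conj.archModule G ιG)
    {u : P.space.toSubmodule} (hu : (u : 𝒢.L2 μ) = star (w : 𝒢.L2 μ)) : u ∈ P.archModule G ιG := by
  have h := (DiscreteAutomorphicRep.mem_archModule_iff_coe P.conj G ιG w).mp hw
  refine (DiscreteAutomorphicRep.mem_archModule_iff_coe P G ιG u).mpr ?_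
  rw [hu]
  exact ⟨contDiff_rightRegular_star G ιG h.1, finiteDimensional_span_rightRegular_star G ιG h.2⟩

/-- **A token of `P̄` conjugates to a token of `P`** with values in the conjugate module: from a non-zero `(𝔤, K)`-map `T : P̄.archModule → M` one gets the
non-zero `(𝔤, K)`-map `u ↦ \overline{T(ū)} : P.archModule → M̄ = ConjVec M` for `(repConj σK, conjRep σ𝔤)` (★ `star_mem_archModule`, ★ `coe_archRepK_conj`,
★ `coe_archRepLie_conj`; non-vanishing because `u ↦ ū` is onto `P̄.archModule`). [cite: Clozel1990, §3.1] [cite: BorelJacquet1979, §4.6] [cite: BorelWallach2000, VII 2.10] -/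
theorem exists_token_conjVec_of_conj_token (hι : Continuous ιG)
    {M : Type} [AddCommGroup M] [Module ℂ M] {σK : Representation ℂ G.maximalCompact M} {σ𝔤 : G.lie →ₗ⁅ℝ⁆ Module.End ℂ M}
    (T : P.conj.archModule G ιG →ₗ[ℂ] M)
    (hTK : ∀ (k : G.maximalCompact) (w : P.conj.archModule G ιG), T (P.conj.archRepK G ιG k w) = σK k (T w))
    (hT𝔤 : ∀ (X : G.lie) (w : P.conj.archModule G ιG), T (P.conj.archRepLie G ιG hι X w) = σ𝔤 X (T w)) (hT : T ≠ 0) :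
    ∃ T' : P.archModule G ιG →ₗ[ℂ] ConjVec M,
      (∀ (k : G.maximalCompact) (u : P.archModule G ιG), T' (P.archRepK G ιG k u) = ConjVec.repConj σK k (T' u)) ∧
        (∀ (X : G.lie) (u : P.archModule G ιG), T' (P.archRepLie G ιG hι X u) = ConjVec.conjRep σ𝔤 X (T' u)) ∧ T' ≠ 0 := by
  -- the conjugation map `P.archModule → P̄.archModule`, `u ↦ ⟨ū⟩`
  let cj : P.archModule G ιG → P.conj.archModule G ιG := fun u =>
    ⟨⟨star ((u : P.space.toSubmodule) : 𝒢.L2 μ), P.star_mem_conj_space (u : P.space.toSubmodule).2⟩, star_mem_archModule P G ιG u⟩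
  have hcj : ∀ u : P.archModule G ιG,
      (((cj u : P.conj.archModule G ιG) : P.conj.space.toSubmodule) : 𝒢.L2 μ) = star ((u : P.space.toSubmodule) : 𝒢.L2 μ) := fun u => rfl
  have hcj_add : ∀ u u' : P.archModule G ιG, cj (u + u') = cj u + cj u' := fun u u' => by
    apply Subtype.ext
    apply Subtype.ext
    rw [hcj]
    change star (((u : P.space.toSubmodule) : 𝒢.L2 μ) + ((u' : P.space.toSubmodule) : 𝒢.L2 μ)) =
      star ((u : P.space.toSubmodule) : 𝒢.L2 μ) + star ((u' : P.space.toSubmodule) : 𝒢.L2 μ)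
    exact AdelicGroupData.L2.star_add 𝒢 μ _ _
  have hcj_smul : ∀ (a : ℂ) (u : P.archModule G ιG), cj (a • u) = starRingEnd ℂ a • cj u := fun a u => by
    apply Subtype.ext
    apply Subtype.ext
    rw [hcj]
    change star (a • ((u : P.space.toSubmodule) : 𝒢.L2 μ)) = starRingEnd ℂ a • star ((u : P.space.toSubmodule) : 𝒢.L2 μ)
    exact AdelicGroupData.L2.star_smul 𝒢 μ a _
  -- `cj` is onto: `w = cj ⟨w̄⟩`
  have hcj_surj : ∀ w : P.conj.archModule G ιG, ∃ u : P.archModule G ιG, cj u = w := by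
    intro w
    have hmem : star (((w : P.conj.archModule G ιG) : P.conj.space.toSubmodule) : 𝒢.L2 μ) ∈ P.space :=
      (P.mem_conj_space_iff).mp ((w : P.conj.archModule G ιG) : P.conj.space.toSubmodule).2
    refine ⟨⟨⟨_, hmem⟩, mem_archModule_of_coe_eq_star_conj P G ιG w.2 rfl⟩, ?_⟩
    apply Subtype.ext
    apply Subtype.ext
    rw [hcj]
    exact star_star _
  let T' : P.archModule G ιG →ₗ[ℂ] ConjVec M :=
    { toFun := fun u => toConj (T (cj u))
      map_add' := fun u u' => by rw [hcj_add, map_add, map_add]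
      map_smul' := fun a u => by rw [RingHom.id_apply, hcj_smul, map_smul, smul_toConj] }
  have hT' : ∀ u, T' u = toConj (T (cj u)) := fun _ => rfl
  refine ⟨T', fun k u => ?_, fun X u => ?_, ?_⟩
  · rw [hT', hT', ConjVec.repConj_apply_toConj, ← hTK]
    congr 2
    apply Subtype.ext
    apply Subtype.ext
    rw [hcj]
    exact (coe_archRepK_conj P G ιG (hcj u) k).symm
  · rw [hT', hT', ConjVec.conjRep_apply_toConj, ← hT𝔤]
    congr 2
    apply Subtype.ext
    apply Subtype.ext
    rw [hcj]
    exact (coe_archRepLie_conj P G ιG hι (hcj u) X).symm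
  · intro h0
    apply hT
    ext w
    obtain ⟨u, rfl⟩ := hcj_surj w
    have h1 : T' u = 0 := by rw [h0, LinearMap.zero_apply]
    rw [hT'] at h1
    rw [LinearMap.zero_apply]
    exact (toConj (V := M)).map_eq_zero_iff.mp h1

end Generic

/-! ## §3 The CM frame: an antiholomorphic-cotangent `P` has a coh-unitary token -/

section CM

variable (L : Type) [Field L] [NumberField L] [IsCMField L] (H : Matrix (Fin 3) (Fin 3) L) (ι : L →+* ℂ) (T : GL (Fin 3) ℂ)
  (hT : (T : Matrix (Fin 3) (Fin 3) ℂ)ᴴ * H.map ι * (T : Matrix (Fin 3) (Fin 3) ℂ) = Literature.Geometry.ComplexHyperbolic.BallModel.J)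
  (μ : Measure (Gp L H).automorphicQuotient) [(Gp L H).IsAutomorphicMeasure μ]

/-- **A HOLOMORPHIC-cotangent `P` has a coh-unitary token** (★ `F0P3ArchTokenUnitary.exists_cohUnitaryIrrep_token_of_isHolCotangentAt_cpt`, re-bundled as a ★ `GKIrrep`
with the ★ `IsCohUnitaryIrrep` bundle). [cite: Rogawski1990, Prop. 15.2.1 (b)] [cite: BorelWallach2000, VI Thm. 4.11] -/
theorem exists_cohUnitaryToken_of_isHolCotangentAt_cpt
    (hdef : ∀ τ' : L →+* ℂ, InfinitePlace.mk τ' ≠ InfinitePlace.mk ι → (H.map τ').PosDef) (h2 : 2 ≤ Module.finrank ℚ ↥(maximalRealSubfield L))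
    (P : DiscreteAutomorphicRep (Gp L H) μ)
    (hP : P.IsHolCotangentAt (cmArchSection L ι H T hT) (cmCompactFactor L ι H T hT)) :
    ∃ r : GKIrrep (uFormGroup (Fin 2) (Fin 1)), HasToken L H ι T hT μ P r.V r.ρK r.ρ𝔤 ∧ IsCohUnitaryIrrep r.ρK r.ρ𝔤 := by
  have hct := F0P3ArchTokenUnitary.exists_cohUnitaryIrrep_token_of_isHolCotangentAt_cpt ι T hT hdef h2 μ P hP
  obtain ⟨M₀, _, _, σK₀, σ𝔤₀, hM₀, hT₀, -⟩ := hct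
  exact ⟨⟨M₀, σK₀, σ𝔤₀, hM₀.gk, hM₀.irred⟩, hT₀, hM₀⟩

/-- **AN ANTIHOLOMORPHIC-cotangent `P` HAS A COH-UNITARY TOKEN**: `P̄` is holomorphic-cotangent (★ `isAntiholCotangentAt_iff_conj`), so has a coh-unitary token (§3 hol);
conjugate it (§2) — its target `M̄` is coh-unitary (§1). [cite: Rogawski1990, Prop. 15.2.1 (b)] [cite: BorelWallach2000, VII 2.10; VI Thm. 4.11] [cite: Clozel1990, §3.1] -/
theorem exists_cohUnitaryToken_of_isAntiholCotangentAt_cpt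
    (hdef : ∀ τ' : L →+* ℂ, InfinitePlace.mk τ' ≠ InfinitePlace.mk ι → (H.map τ').PosDef) (h2 : 2 ≤ Module.finrank ℚ ↥(maximalRealSubfield L))
    (P : DiscreteAutomorphicRep (Gp L H) μ)
    (hP : P.IsAntiholCotangentAt (cmArchSection L ι H T hT) (cmCompactFactor L ι H T hT)) :
    ∃ r : GKIrrep (uFormGroup (Fin 2) (Fin 1)), HasToken L H ι T hT μ P r.V r.ρK r.ρ𝔤 ∧ IsCohUnitaryIrrep r.ρK r.ρ𝔤 := by
  have hPc : P.conj.IsHolCotangentAt (cmArchSection L ι H T hT) (cmCompactFactor L ι H T hT) :=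
    (CotangentForms.isAntiholCotangentAt_iff_conj P (cmArchSection L ι H T hT) (cmCompactFactor L ι H T hT)).mp hP
  have hct := exists_cohUnitaryToken_of_isHolCotangentAt_cpt L H ι T hT μ hdef h2 P.conj hPc
  obtain ⟨r, ⟨T₁, hT₁K, hT₁𝔤, hT₁⟩, hr⟩ := hct
  have htr := exists_token_conjVec_of_conj_token P (uFormGroup (Fin 2) (Fin 1)) (cmArchSectionUForm L ι H T hT)
    (continuous_cmArchSectionUForm L ι H T hT) T₁ hT₁K hT₁𝔤 hT₁
  obtain ⟨T', hT'K, hT'𝔤, hT'⟩ := htr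
  have hr' := isCohUnitaryIrrep_repConj hr
  exact ⟨⟨ConjVec r.V, ConjVec.repConj r.ρK, ConjVec.conjRep r.ρ𝔤, hr'.gk, hr'.irred⟩, ⟨T', hT'K, hT'𝔤, hT'⟩, hr'⟩

/-- **A COTANGENT `P` (holomorphic OR antiholomorphic — the head's guard `IsCot`, RULING (V30)) has a coh-unitary token.** [cite: Rogawski1990, Prop. 15.2.1 (b)]
[cite: BorelWallach2000, VI Thm. 4.11; VII 2.10] -/
theorem exists_cohUnitaryToken_of_isCot_cpt
    (hdef : ∀ τ' : L →+* ℂ, InfinitePlace.mk τ' ≠ InfinitePlace.mk ι → (H.map τ').PosDef) (h2 : 2 ≤ Module.finrank ℚ ↥(maximalRealSubfield L))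
    (P : DiscreteAutomorphicRep (Gp L H) μ)
    (hP : P.IsHolCotangentAt (cmArchSection L ι H T hT) (cmCompactFactor L ι H T hT) ∨
      P.IsAntiholCotangentAt (cmArchSection L ι H T hT) (cmCompactFactor L ι H T hT)) :
    ∃ r : GKIrrep (uFormGroup (Fin 2) (Fin 1)), HasToken L H ι T hT μ P r.V r.ρK r.ρ𝔤 ∧ IsCohUnitaryIrrep r.ρK r.ρ𝔤 := by
  rcases hP with hP | hP
  · exact exists_cohUnitaryToken_of_isHolCotangentAt_cpt L H ι T hT μ hdef h2 P hP
  · exact exists_cohUnitaryToken_of_isAntiholCotangentAt_cpt L H ι T hT μ hdef h2 P hP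

/-! ## §4 Law `TokenInf` at `𝔠₀` for `clInf := clInfChoiceU dflt ∘ rep`, under the guard `IsCot` -/

/-- **LAW `TokenInf` AT `𝔠₀` for `clInfChoiceU`, ANTIHOLOMORPHIC INSTANCE**: F1a for the antihol `P` is ★ (`archIsotypy_cm_of_hol_half` ∘ `archIsotypy_of_isHolCotangentAt`)
and §3 gives a coh-unitary token, so (B-i) `tokenInfU_of_exists_cohUnitaryToken` applies. [cite: Rogawski1990, Prop. 15.2.1 (b); §15.3] [cite: BorelWallach2000, VI Thm. 4.11] -/
theorem tokenInfU_of_isAntiholCotangentAt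
    (hdef : ∀ τ' : L →+* ℂ, InfinitePlace.mk τ' ≠ InfinitePlace.mk ι → (H.map τ').PosDef) (h2 : 2 ≤ Module.finrank ℚ ↥(maximalRealSubfield L))
    (dflt : Cinf) (P : DiscreteAutomorphicRep (Gp L H) μ)
    (hP : P.IsAntiholCotangentAt (cmArchSection L ι H T hT) (cmCompactFactor L ι H T hT))
    {M : Type} [AddCommGroup M] [Module ℂ M] {σK : Representation ℂ (uFormGroup (Fin 2) (Fin 1)).maximalCompact M}
    {σ𝔤 : (uFormGroup (Fin 2) (Fin 1)).lie →ₗ⁅ℝ⁆ Module.End ℂ M} (hM : IsGKModule (uFormGroup (Fin 2) (Fin 1)) σK σ𝔤) (hirr : IsIrreducibleGK σK σ𝔤)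
    (htok : HasToken L H ι T hT μ P M σK σ𝔤) :
    clInfChoiceU L H ι T hT μ dflt (rep (Gp L H) μ (cl (Gp L H) μ P)) = GKIrrClass.ofModule M σK σ𝔤 hM hirr := by
  have hF1a : P.ArchIsotypy (uFormGroup (Fin 2) (Fin 1)) (cmArchSectionUForm L ι H T hT) :=
    archIsotypy_cm_of_hol_half L ι H T hT μ (fun P' hP' => F0P3StubF1aHolHalf.archIsotypy_of_isHolCotangentAt ι T hT hdef h2 μ P' hP') P (Or.inr hP)
  exact tokenInfU_of_exists_cohUnitaryToken L H ι T hT μ dflt P hF1a (exists_cohUnitaryToken_of_isAntiholCotangentAt_cpt L H ι T hT μ hdef h2 P hP)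
    hM hirr htok

/-- **LAW `TokenInf` AT `𝔠₀` (dossier v5 :471) with `clInf := clInfChoiceU dflt ∘ rep`, UNDER THE HEAD'S GUARD `IsCot P`** (holomorphic OR antiholomorphic cotangent
type): every token `(M, σK, σ𝔤)` of `P` pins `clInfChoiceU dflt (rep (cl P)) = GKIrrClass.ofModule M σK σ𝔤` — a THEOREM for both disjuncts, 0 letters (hol: (B-i)
`tokenInfU_of_isHolCotangentAt`; antihol: above). [cite: Rogawski1990, Prop. 15.2.1 (b); §15.3] [cite: BorelWallach2000, VI Thm. 4.11; VII 2.10] [cite: FlathCorvallis1979, Thm. 3 and Thm. 4] -/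
theorem tokenInfU_of_isCot
    (hdef : ∀ τ' : L →+* ℂ, InfinitePlace.mk τ' ≠ InfinitePlace.mk ι → (H.map τ').PosDef) (h2 : 2 ≤ Module.finrank ℚ ↥(maximalRealSubfield L))
    (dflt : Cinf) (P : DiscreteAutomorphicRep (Gp L H) μ)
    (hP : P.IsHolCotangentAt (cmArchSection L ι H T hT) (cmCompactFactor L ι H T hT) ∨
      P.IsAntiholCotangentAt (cmArchSection L ι H T hT) (cmCompactFactor L ι H T hT))
    {M : Type} [AddCommGroup M] [Module ℂ M] {σK : Representation ℂ (uFormGroup (Fin 2) (Fin 1)).maximalCompact M}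
    {σ𝔤 : (uFormGroup (Fin 2) (Fin 1)).lie →ₗ⁅ℝ⁆ Module.End ℂ M} (hM : IsGKModule (uFormGroup (Fin 2) (Fin 1)) σK σ𝔤) (hirr : IsIrreducibleGK σK σ𝔤)
    (htok : HasToken L H ι T hT μ P M σK σ𝔤) :
    clInfChoiceU L H ι T hT μ dflt (rep (Gp L H) μ (cl (Gp L H) μ P)) = GKIrrClass.ofModule M σK σ𝔤 hM hirr := by
  rcases hP with hP | hP
  · exact tokenInfU_of_isHolCotangentAt L H ι T hT μ hdef h2 dflt P hP hM hirr htok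
  · exact tokenInfU_of_isAntiholCotangentAt L H ι T hT μ hdef h2 dflt P hP hM hirr htok

end CM

end Summit.HodgeConjecture.HodgeConjecture.Cruxes.H413.F0P3AntiholCohUnitaryToken
end
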